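import Literature.MathematicalPhysics.QuantumLattice.HubbardKuboKishiFSum
import Literature.MathematicalPhysics.QuantumLattice.HubbardKuboKishiGaussianDomination
import Literature.MathematicalPhysics.QuantumLattice.HubbardUniformDensityGibbs
import HarnessLib

/-!
# Kubo–Kishi 1990, Theorem 2 at `q = 0`: the compressibility of the half-filled repulsive Hubbard
# model on a bipartite lattice is at most `U⁻¹` per site, at every temperature, in every dimension

Topic `MathematicalPhysics/QuantumLattice` (family `hubbard`). K. Kubo, T. Kishi, *Rigorous bounds on
the susceptibilities of the Hubbard model*, Phys. Rev. B **41** (1990) 4866–4868 [KuboKishi1990]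
(reprinted in A. Montorsi (ed.), *The Hubbard Model*, World Scientific 1992; read there, reprint
pp. 122–123 = PRB p. 4867).

Kubo–Kishi's Theorem 2: for `U > 0`, `μ_{ασ} = U/2` and bipartite hopping, "the charge and the on-site
pairing susceptibilities satisfy `β(δn_q, δn_{-q}) ≤ U⁻¹`" (eq. (5)) at EVERY wave vector `q`, where
`(A, B)` is the Duhamel two-point function (their eq. after (2)) and `n_q = |Λ|^{-1/2} Σ_α n_α e^{-iq·α}`.
At `q = 0` this is the bound `β (N - |Λ|, N - |Λ|)_Duh ≤ |Λ|/U` on the UNIFORM charge susceptibility,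
and by the linear-response (susceptibility) formula `∂⟨N⟩_{β,μ}/∂μ = β[(N, N)_Duh - ⟨N⟩²]`
(Bratteli–Robinson II §5.4.1; tree `hasDerivAt_re_gibbsState_source`) that Duhamel function IS the
`μ`-derivative of the mean particle number of the grand-canonical state of `H(t,U) - μN` at `μ = U/2`
(where `⟨N⟩ = |Λ|`, Lieb–Loss–McCann, tree `hubbard_gibbsState_totalNumber_halfFilling`). Hence the
thermodynamic statement proved here:

* `hubbard_hasDerivAt_re_gibbsState_totalNumber` — for every `μ₀`, `μ ↦ Re ⟨N⟩_{β, H(t,U) - μN}` is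
  differentiable with derivative `β [Re (N, N)_{Duh, μ₀} - (Re ⟨N⟩_{μ₀})²]` (the susceptibility formula,
  `A = N`);
* `hubbard_duhamel_totalNumber_variance_halfFilled` — at `μ₀ = U/2` on a bipartite-signed graph this
  Duhamel variance equals `Re (D_1, D_1)_Duh`, `D_1 = Σ_x (n_x - 1) = N - |Λ|` the uniform charge field
  (`chargeDensityField 1`);
* **`hubbard_halfFilled_compressibility_le`** — for every finite bipartite-signed graph, every `t`,
  every `U > 0` and every `0 < β < ∞`:
  `0 ≤ ∂_μ Re ⟨N⟩_{β,μ} |_{μ = U/2} ≤ |Λ| / U`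
  (Kubo–Kishi (5) at `q = 0`, `kuboKishi_charge_duhamel_le` with `a ≡ 1`, from the PROVED Gaussian
  domination `kuboKishi_charge_gaussianDomination_holds`; nonnegativity is `(A, A)_Duh ≥ 0`). An
  `L`-uniform, `U`-explicit ceiling on the charge compressibility `κ = |Λ|⁻¹ ∂⟨N⟩/∂μ ≤ 1/U` of the
  half-filled repulsive Hubbard model at every temperature and in every dimension — the incipient
  incompressibility of the half-filled (Mott) regime as far as it is rigorously known at `T > 0`;
* `hubbardTorus_halfFilled_compressibility_le` — the same on the even torus `(ℤ/Lℤ)^d`: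
  `∂_μ Re ⟨N⟩ |_{U/2} ≤ L^d / U`.

Scope (honest): the derivative AT `μ = U/2` only (where the bipartite particle–hole symmetry makes
Kubo–Kishi's Theorem 2 available), finite lattices (the bound is uniform in `|Λ|` per site), `U > 0`,
`β > 0`; no statement at `T = 0`, away from half filling, or on a gap. Theorems only; no definition, no
named fact, no statement of the tree is changed.
HONEST FRAMING (cell pub-hubbard): ladder R1–R4 with certified numbers; no claim on H/H₀.

References: [KuboKishi1990] Theorem 2, eq. (5), Remark 2 (PRB 41, p. 4867); O. Bratteli,
D. W. Robinson, *Operator Algebras and QSM 2* (1997) §5.4.1 (linear response = Duhamel function)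
[BratteliRobinsonII1997]; [DLS1978] eq. (5); E. H. Lieb, M. Loss, R. J. McCann, J. Math. Phys. 34
(1993) 891, eq. (5) (uniform density) [LiebLossMccann1993].
-/

noncomputable section

namespace Literature.MathematicalPhysics.QuantumLattice

open Matrix Finset HubbardWave0
open scoped ComplexOrder

section General

variable {Λ : Type} [LinearOrder Λ] [Fintype Λ] (G : SimpleGraph Λ) [DecidableRel G.Adj]

omit [DecidableRel G.Adj] in
/-- The uniform charge field is the centred particle number: `D_1 = Σ_x (n_x - 1) = N - |Λ|·1`.
Kubo–Kishi (1990), Theorem 2 (`δn_0`). [cite: KuboKishi1990, Theorem 2, eq. (5)] -/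
theorem chargeDensityField_one_eq_totalNumber_sub :
    chargeDensityField (fun _ : Λ => (1 : ℝ)) =
      totalNumber - (Fintype.card Λ : ℂ) • (1 : Matrix (Finset (Orb Λ)) (Finset (Orb Λ)) ℂ) := by
  have hN : (totalNumber : Matrix (Finset (Orb Λ)) (Finset (Orb Λ)) ℂ) =
      ∑ x : Λ, (numberOp x 0 + numberOp x 1) := by
    unfold totalNumber
    exact Finset.sum_congr rfl fun x _ => Fin.sum_univ_two _
  unfold chargeDensityField
  simp only [Complex.ofReal_one, one_smul]
  rw [Finset.sum_sub_distrib, hN, Finset.sum_const, Finset.card_univ, ← Nat.cast_smul_eq_nsmul ℂ]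

/-- The total particle number is Hermitian (plumbing). [folklore] -/
private theorem isHermitian_totalNumber' :
    (totalNumber : Matrix (Finset (Orb Λ)) (Finset (Orb Λ)) ℂ).IsHermitian := by
  unfold Matrix.IsHermitian totalNumber
  simp only [conjTranspose_sum]
  refine Finset.sum_congr rfl fun x _ => Finset.sum_congr rfl fun σ _ => ?_
  exact (numberAt_isHermitian (orb x σ)).eq

/-- **The susceptibility formula for the particle number**: for every `μ₀`, `t`, `U` and `β > 0`,
`μ ↦ Re ⟨N⟩_{β, H(t,U) - μN}` is differentiable at `μ₀` with derivative
`β [Re (N, N)_{Duh; β, μ₀} - (Re ⟨N⟩_{β,μ₀})²]` — the static uniform charge susceptibility is the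
Duhamel variance of `N` (tree `hasDerivAt_re_gibbsState_source` with source `A = N`;
`H(t,U) - μN = hamiltonianWith G t U μ` definitionally). Bratteli–Robinson II §5.4.1.
[cite: BratteliRobinsonII1997, §5.4.1] -/
theorem hubbard_hasDerivAt_re_gibbsState_totalNumber [Nonempty Λ] (t U : ℝ) {β : ℝ} (hβ : 0 < β)
    (μ₀ : ℝ) :
    HasDerivAt (fun μ : ℝ => (gibbsState β (hamiltonianWith G t U μ) totalNumber).re)
      (β * ((duhamel β (hamiltonianWith G t U μ₀) totalNumber totalNumber).re -
        (gibbsState β (hamiltonianWith G t U μ₀) totalNumber).re ^ 2)) μ₀ := by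
  have hH : (hamiltonian G t U).IsHermitian := by
    rw [← hamiltonianWith_zero]
    exact isHermitian_hamiltonianWith G t U 0
  exact hasDerivAt_re_gibbsState_source hH isHermitian_totalNumber' hβ μ₀

/-- **At half filling the Duhamel variance of `N` is the uniform charge susceptibility `(D_1, D_1)`**:
on a bipartite-signed graph at `μ = U/2`, `Re (N, N)_Duh - (Re ⟨N⟩)² = Re (D_1, D_1)_Duh` with
`D_1 = N - |Λ|` — since `⟨N⟩ = |Λ|` (Lieb–Loss–McCann) and `(N - c, N - c) = (N,N) - 2c⟨N⟩ + c²`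
(`duhamel_sub_smul_one`). Kubo–Kishi (1990), Remark 2 (`δn = n - ⟨n⟩`, `⟨n_{ασ}⟩ = ½`).
[cite: KuboKishi1990, Theorem 2 and Remark 2] [cite: LiebLossMccann1993, Theorem eq. (5)] -/
theorem hubbard_duhamel_totalNumber_variance_halfFilled [Nonempty Λ] (ε : Λ → ℤˣ)
    (hε : ∀ x y, G.Adj x y → ε x = -ε y) (t U β : ℝ) :
    (duhamel β (hamiltonianWith G t U (U / 2)) totalNumber totalNumber).re -
        (gibbsState β (hamiltonianWith G t U (U / 2)) totalNumber).re ^ 2 =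
      (duhamel β (hamiltonianWith G t U (U / 2)) (chargeDensityField fun _ : Λ => (1 : ℝ))
        (chargeDensityField fun _ : Λ => (1 : ℝ))).re := by
  have hN := hubbard_gibbsState_totalNumber_halfFilling G ε hε t U β
  rw [chargeDensityField_one_eq_totalNumber_sub,
    duhamel_sub_smul_one (isHermitian_hamiltonianWith G t U (U / 2)) β totalNumber (Fintype.card Λ : ℂ),
    hN]
  simp only [Complex.sub_re, Complex.add_re, Complex.natCast_re]
  have h2 : ((2 : ℂ) * (Fintype.card Λ : ℂ) * (Fintype.card Λ : ℂ)).re =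
      2 * (Fintype.card Λ : ℝ) * (Fintype.card Λ : ℝ) := by norm_cast
  have hsq : (((Fintype.card Λ : ℂ)) ^ 2).re = (Fintype.card Λ : ℝ) ^ 2 := by norm_cast
  rw [h2, hsq]
  ring

/-- **Kubo–Kishi 1990, Theorem 2 at `q = 0`: the compressibility of the half-filled repulsive Hubbard
model on a bipartite lattice is at most `U⁻¹` per site.** For every finite bipartite-signed graph,
every `t`, every `U > 0` and every `0 < β < ∞`, the mean particle number of the grand-canonical Gibbs
state of `H(t,U) - μN` satisfies `0 ≤ ∂_μ Re ⟨N⟩_{β,μ} |_{μ = U/2} ≤ |Λ|/U`: the derivative is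
`β Re (D_1, D_1)_Duh` (susceptibility formula + half filling), which Kubo–Kishi's (5) at `q = 0`
bounds by `β · |Λ|/(βU)` (`kuboKishi_charge_duhamel_le`, `a ≡ 1`, Gaussian domination
`kuboKishi_charge_gaussianDomination_holds`), and which is nonnegative (`(A,A)_Duh ≥ 0`). "In the
half-filled repulsive model on a bipartite lattice the charge … susceptibilities are bounded above by
`U⁻¹`." [cite: KuboKishi1990, Theorem 2, eq. (5) (q = 0), abstract (PRB 41, pp. 4866–4867)]
[cite: BratteliRobinsonII1997, §5.4.1] -/
theorem hubbard_halfFilled_compressibility_le [Nonempty Λ] (ε : Λ → ℤˣ)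
    (hε : ∀ x y, G.Adj x y → ε x = -ε y) (t : ℝ) {U β : ℝ} (hU : 0 < U) (hβ : 0 < β) :
    0 ≤ deriv (fun μ : ℝ => (gibbsState β (hamiltonianWith G t U μ) totalNumber).re) (U / 2) ∧
    deriv (fun μ : ℝ => (gibbsState β (hamiltonianWith G t U μ) totalNumber).re) (U / 2) ≤
      (Fintype.card Λ : ℝ) / U := by
  rw [(hubbard_hasDerivAt_re_gibbsState_totalNumber G t U hβ (U / 2)).deriv,
    hubbard_duhamel_totalNumber_variance_halfFilled G ε hε t U β]
  have hKK := kuboKishi_charge_duhamel_le G kuboKishi_charge_gaussianDomination_holds ε hε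
    (t := t) hU hβ fun _ : Λ => (1 : ℝ)
  simp only [one_pow, Finset.sum_const, Finset.card_univ, nsmul_eq_mul, mul_one] at hKK
  refine ⟨mul_nonneg hβ.le ((isHermitian_hamiltonianWith G t U (U / 2)).re_duhamel_self_nonneg
    (isHermitian_chargeDensityField _) β), ?_⟩
  calc β * (duhamel β (hamiltonianWith G t U (U / 2)) (chargeDensityField fun _ : Λ => (1 : ℝ))
        (chargeDensityField fun _ : Λ => (1 : ℝ))).re
      ≤ β * ((Fintype.card Λ : ℝ) / U / β) := mul_le_mul_of_nonneg_left hKK hβ.le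
    _ = (Fintype.card Λ : ℝ) / U := by field_simp

end General

/-! ### The even torus `(ℤ/Lℤ)^d` -/

section Torus

variable {d L : ℕ}

/-- The fermionic torus has `L^d` sites (private copy). [folklore] -/
private theorem card_fermionTorus_c : Fintype.card (FermionTorus d L) = L ^ d := by
  change Fintype.card (Fin d → Fin L) = L ^ d
  rw [Fintype.card_fun, Fintype.card_fin, Fintype.card_fin]

/-- **Compressibility of the half-filled repulsive Hubbard torus, every dimension**: for `L` even,
`L ≥ 1`, every `d`, `t`, `U > 0`, `0 < β < ∞`,
`0 ≤ ∂_μ Re ⟨N⟩_{β, hubbardTorusWith d L t U μ} |_{μ = U/2} ≤ L^d / U` (bipartite sign `torusStagger`).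
[cite: KuboKishi1990, Theorem 2, eq. (5) (q = 0)] -/
theorem hubbardTorus_halfFilled_compressibility_le [NeZero L] (hL : Even L) (t : ℝ) {U β : ℝ}
    (hU : 0 < U) (hβ : 0 < β) :
    0 ≤ deriv (fun μ : ℝ => (gibbsState β (hubbardTorusWith d L t U μ) totalNumber).re) (U / 2) ∧
    deriv (fun μ : ℝ => (gibbsState β (hubbardTorusWith d L t U μ) totalNumber).re) (U / 2) ≤
      (L : ℝ) ^ d / U := by
  haveI : Nonempty (FermionTorus d L) := ⟨toLex fun _ => ⟨0, Nat.pos_of_ne_zero (NeZero.ne L)⟩⟩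
  have h := hubbard_halfFilled_compressibility_le (fermionTorusGraph d L) torusStagger
    (fun _ _ h => torusStagger_eq_neg_of_adj_holds hL h) t hU hβ
  rw [card_fermionTorus_c, Nat.cast_pow] at h
  unfold hubbardTorusWith
  -- `convert`: structural versus order-derived `DecidableEq` instance on the orbitals
  convert h

end Torus

end Literature.MathematicalPhysics.QuantumLattice
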